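import Literature.IUT.HodgeTheaters.PiAvatarNFKit
import Literature.IUT.HodgeTheaters.KitNFSideEval
import HarnessLib

/-!
# «KITCORE-AT-GENUINE-KIT»: the [IUTchI] §4 base-Θ datum `BaseThetaDatum` and its `𝒟`-level dictionary `KitCore`/`NFLink` AT THE REAL
# INITIAL Θ-DATA (Π-avatar, NF-widened stand-in kit), modulo Example 4.4's evaluation-section binder at `v̲ ∈ V̲^bad` — and the junction
# finding J-Θ-1 on that binder (defs + laws — post-freeze additive D13, not a cone member)

S. Mochizuki, *Inter-universal Teichmüller theory I*, kurims manuscript (May 2020), Def 4.1 (i)–(vi) pp. 95–97 (the base-Θ data `𝒟_v`, `𝒟^⊢_v`,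
`𝒟^⊚`, `LabCusp`, `φ^NF`), Ex 4.3 pp. 98–100, Ex 4.4 (i)(ii) pp. 105–107 («the various morphisms `ℬ^temp(Π_v̲)⁰ → ℬ^temp(Π_v̲)⁰` that arise [i.e.,
via composition with the natural surjection `Π_v̲ ↠ G_v̲`] from the evaluation sections labeled `j`»), Ex 4.5 pp. 107–108, Prop 6.7 p. 167 («the
poly-morphisms described [via group-theoretic algorithms!] in Example 4.4, (i), (ii)») ([IUTchI] Def 4.1 p.95) [claim: Mochizuki2012, status: disputed]
(D-0012 claim key, series status DISPUTED — constructions over abc-iut-L5-t2's REAL `InitialThetaData`, abc-iut-L5-t1's `CuspGalois`, abc-iut-L5-t4's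
NF-widened stand-in kit `baseKitNFStandIn` (p450281) and abc-iut-L5-t3's NF kit `nfKitStandIn` (p451329); nothing of the series is asserted, no
side is taken on [IUTchIII] Cor. 3.12).

WHAT (L5-lead row «KITCORE-AT-GENUINE-KIT», the §4↔§6 junction of w6-d045's census).  abc-iut-L5-t3's converse dictionary
`BaseThetaDatum.ofKitCore K hl5 hba hb N B E` / `KitCore.ofKit` / `NFLink.ofKit` (KitNFSideDatum, p425584) builds a §4 base-Θ datum `𝔡` with a
`KitCore 𝔡 K` from a base kit `K`, its NF kit `N`, a mono-analytic binder `B` and an evaluation-section binder `E`.  At the REAL datum: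
`K := D.baseKitNFStandIn CG hS M hA hI` (Π-avatar, `Amb v := AmbNF`; «[`X̲→`-profinite stand-in at `v̲ ∈ V̲^bad`]»), `N := D.nfKitStandIn CG hS M hA hI`
(every NF-side law a theorem), `hl5 := D.five_le_l` (Def 3.1 (c)), `hba` := `V̲^bad ∩ V̲^arc = ∅` (`indexCopy_not_mem_arc_of_mem_bad`, from abc-iut-L5-t2's
`Varc_subset_Vgood`/`disjoint_Vbad_Vgood`), `hb` := `V̲^bad ≠ ∅` (abc-iut-L5-t4's `PlaceKit.bad_nonempty`), `B := MonoBinder.tautological` («[mono-analytic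
stand-in]»: Def 4.1 (iii)(iv) `𝒟^⊢_v` not modelled, KitNFSideEval), and `E` REMAINS A BINDER — **junction finding J-Θ-1** (recorded, not repaired here):
in the Π-avatar ambient (design D1 EMBEDDED: the orbit category of ONE group) the morphisms `ℬ(H)⁰ → ℬ(H)⁰` are the coset maps `xH ↦ xdH`
(`d⁻¹Hd ≤ H`; `OrbitCat.exists_eq_homOfElem`), whereas Example 4.4 (i)'s `φ^Θ_{v̲_j}` at `v̲ ∈ V̲^bad` are the composites «`Π_v̲ ↠ G_v̲` followed by an
evaluation section `G_v̲ → Π_v̲`» — outer homomorphisms that are NOT injective, hence NOT morphisms of `Amb v` at any Π-avatar kit: the binder `E`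
(and abc-iut-L5-t4's `MultKit.thetaPolyBad`) can be INHABITED there only by stand-ins; faithful hosting of Ex 4.4 needs an ambient with all
continuous outer homomorphisms at `v̲ ∈ V̲^bad` (the tempered/[EtTh] lane, after-merge L3).  RESULTS: **`baseThetaDatumStandIn E`**, **`kitCoreStandIn E`**,
**`nfLinkStandIn E`** (for EVERY `E`), the law **(γ) `thetaAgrees_standIn`** for every multiplicative kit `Mk` with Example 4.4's classes (`Mk.evalBinder`,
inputs `Z`/`hne`/`hrig`/`hsat` BY NAME, KitNFSideEval `thetaAgrees_ofKit`), and `rfl` bookkeeping.  BINDERS, exhaustively: {`CG`, `hS`, `M`, `hA`, `hI`} of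
the kit, `E` (Ex 4.4 (i)(ii) at bad places; J-Θ-1), and for (γ) the multiplicative kit `Mk` with `Z`, `hne`, `hrig`, `hsat`.
No instance, no notation; typed ≠ inhabited ≠ proved; binder ≠ fact; a stand-in witnesses the consistency of OUR binders only.
-/

noncomputable section

namespace Literature.IUT.HodgeTheaters

open CategoryTheory

universe u v w

section KitCoreAtGenuineKit

variable {F : Type u} {K : Type v} {Fbar : Type w} [Field F] [NumberField F] [Field K] [NumberField K]
  [Algebra F K] [Field Fbar] [Algebra F Fbar] [Algebra K Fbar]
  {E : WeierstrassCurve F} [E.IsElliptic] {l : ℕ} {Pb : BadPlacePredicates K}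
  (D : InitialThetaData F K Fbar E l Pb) (CG : D.geom.pe.CuspGalois) (hS : D.CuspClassesNormaliserStable) [Fact l.Prime]
  (M : D.TorsionMonodromy) (hA : D.geom.pe.ArrowCoveringClaims)
  (hI : ∀ k ∈ D.geom.pe.inertia D.geom.pe.ε1, M.tau (D.geom.embK k) = 0)

namespace InitialThetaData

/-! ### The two place inputs of `ofKitCore` at `V̲` -/

omit [Fact l.Prime] in
/-- **`V̲^bad ∩ V̲^arc = ∅` on the index copy** (Def 3.1 (b): `V^bad_mod` is a set of NONARCHIMEDEAN valuations; abc-iut-L5-t2's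
`Varc_subset_Vgood`, `disjoint_Vbad_Vgood`). ([IUTchI] Def 3.1 (b) p.61) [claim: Mochizuki2012, status: disputed] -/
theorem indexCopy_not_mem_arc_of_mem_bad : ∀ x ∈ D.indexCopyBad, x ∉ D.indexCopyArc := by
  intro x hb ha
  rw [D.mem_indexCopyBad_iff] at hb
  rw [D.mem_indexCopyArc_iff] at ha
  exact Set.disjoint_left.mp D.disjoint_Vbad_Vgood hb (D.Varc_subset_Vgood ha)

omit [Fact l.Prime] in
/-- **`V̲^bad ≠ ∅` on the index copy** (Def 3.1 (b): «a NONEMPTY set»; abc-iut-L5-t2's `Vbad_nonempty`).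
([IUTchI] Def 3.1 (b) p.61) [claim: Mochizuki2012, status: disputed] -/
theorem indexCopyBad_nonempty : D.indexCopyBad.Nonempty := by
  obtain ⟨w, hw⟩ := D.Vbad_nonempty
  refine ⟨D.indexCopyEquiv.symm ⟨w, D.Vbad_union_Vgood.subset (Or.inl hw)⟩, ?_⟩
  rw [D.mem_indexCopyBad_iff]
  change ((D.indexCopyEquiv (D.indexCopyEquiv.symm ⟨w, _⟩)) : Val K) ∈ D.Vbad
  rw [Equiv.apply_symm_apply]
  exact hw

/-! ### The §4 base-Θ datum and its dictionaries at the genuine (stand-in) kit, modulo `E` -/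

/-- **THE [IUTchI] §4 BASE-Θ DATUM OF THE REAL INITIAL Θ-DATA** (Π-avatar; NF-widened stand-in kit), modulo the evaluation-section binder `E`
of Example 4.4 at the bad places (J-Θ-1): `ofKitCore` at `K := baseKitNFStandIn`, `N := nfKitStandIn`, `B := MonoBinder.tautological`
(«[mono-analytic stand-in]»), `hl5 := five_le_l`, `hba`, `hb` the two place theorems above. ([IUTchI] Def 4.1 p.95) [claim: Mochizuki2012, status: disputed] -/
def baseThetaDatumStandIn (Ev : (D.baseKitNFStandIn CG hS M hA hI).EvalBinder) : BaseThetaDatum.{w} :=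
  BaseThetaDatum.ofKitCore (D.baseKitNFStandIn CG hS M hA hI) D.five_le_l (D.indexCopy_not_mem_arc_of_mem_bad)
    D.indexCopyBad_nonempty (D.nfKitStandIn CG hS M hA hI)
    (PMBaseKit.MonoBinder.tautological _) Ev

/-- **`KitCore` AT THE GENUINE KIT**: the `𝒟`-level dictionary between the §4 datum `baseThetaDatumStandIn E` and the §6 base kit
`baseKitNFStandIn` — the identity dictionary `KitCore.ofKit` (`e = id`, `amb v` = the inclusion of the local objects, `ambModel = refl`).
([IUTchI] Def 6.1 p.156) [claim: Mochizuki2012, status: disputed] -/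
def kitCoreStandIn (Ev : (D.baseKitNFStandIn CG hS M hA hI).EvalBinder) :
    (D.baseThetaDatumStandIn CG hS M hA hI Ev).KitCore (D.baseKitNFStandIn CG hS M hA hI) :=
  BaseThetaDatum.KitCore.ofKit (D.baseKitNFStandIn CG hS M hA hI) D.five_le_l (D.indexCopy_not_mem_arc_of_mem_bad)
    D.indexCopyBad_nonempty (D.nfKitStandIn CG hS M hA hI) (PMBaseKit.MonoBinder.tautological _) Ev

/-- **`NFLink` AT THE GENUINE KIT**: the `φ^NF` dictionary over `kitCoreStandIn` — the identity (`homNF = Subtype.val`, laws `rfl`).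
([IUTchI] Ex 4.3 (ii) p.99) [claim: Mochizuki2012, status: disputed] -/
def nfLinkStandIn (Ev : (D.baseKitNFStandIn CG hS M hA hI).EvalBinder) : (D.kitCoreStandIn CG hS M hA hI Ev).NFLink :=
  BaseThetaDatum.NFLink.ofKit (D.baseKitNFStandIn CG hS M hA hI) D.five_le_l (D.indexCopy_not_mem_arc_of_mem_bad)
    D.indexCopyBad_nonempty (D.nfKitStandIn CG hS M hA hI) (PMBaseKit.MonoBinder.tautological _) Ev

/-! ### Bookkeeping (`rfl`): what the genuine §4 datum is made of -/

/-- Its prime is `l`. ([IUTchI] Def 3.1 (c) p.61) [claim: Mochizuki2012, status: disputed] -/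
theorem baseThetaDatumStandIn_l (Ev : (D.baseKitNFStandIn CG hS M hA hI).EvalBinder) :
    (D.baseThetaDatumStandIn CG hS M hA hI Ev).l = l := rfl

/-- Its places are the index copy of `V̲`. ([IUTchI] Def 3.1 (e) p.62) [claim: Mochizuki2012, status: disputed] -/
theorem baseThetaDatumStandIn_V (Ev : (D.baseKitNFStandIn CG hS M hA hI).EvalBinder) :
    (D.baseThetaDatumStandIn CG hS M hA hI Ev).V = D.IndexCopy := rfl

/-- Its bad places are `V̲^bad`. ([IUTchI] Def 3.1 (e) p.62) [claim: Mochizuki2012, status: disputed] -/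
theorem baseThetaDatumStandIn_isBad_iff (Ev : (D.baseKitNFStandIn CG hS M hA hI).EvalBinder) (x : D.IndexCopy) :
    (D.baseThetaDatumStandIn CG hS M hA hI Ev).IsBad x ↔ D.indexCopyVal x ∈ D.Vbad := D.mem_indexCopyBad_iff x

/-- Its archimedean places are `V̲^arc`. ([IUTchI] Def 3.1 (e) p.62) [claim: Mochizuki2012, status: disputed] -/
theorem baseThetaDatumStandIn_isArc_iff (Ev : (D.baseKitNFStandIn CG hS M hA hI).EvalBinder) (x : D.IndexCopy) :
    (D.baseThetaDatumStandIn CG hS M hA hI Ev).IsArc x ↔ D.indexCopyVal x ∈ D.Varc := D.mem_indexCopyArc_iff x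

/-- Its `𝒟_v` (Def 4.1 (i)) is the kit's local model `ℬ(Π_v̲)⁰` (as a local object). ([IUTchI] Def 4.1 (i) p.95) [claim: Mochizuki2012, status: disputed] -/
theorem baseThetaDatumStandIn_D (Ev : (D.baseKitNFStandIn CG hS M hA hI).EvalBinder) (x : D.IndexCopy) :
    (D.baseThetaDatumStandIn CG hS M hA hI Ev).D x = (D.baseKitNFStandIn CG hS M hA hI).localModel x := rfl

/-- Its `𝒟^⊚` (Def 4.1 (v)) is `ℬ(Π_{C̲_K})⁰` among the isomorphs `GlobNF`. ([IUTchI] Def 4.1 (v) p.97) [claim: Mochizuki2012, status: disputed] -/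
theorem baseThetaDatumStandIn_DG (Ev : (D.baseKitNFStandIn CG hS M hA hI).EvalBinder) :
    (D.baseThetaDatumStandIn CG hS M hA hI Ev).DG = D.gnfModel := rfl

/-- Its class `[ε]` (Ex 4.5 (ii)) is `1 ∈ 𝔽_l^⋇`. ([IUTchI] Ex 4.5 (ii) p.108) [claim: Mochizuki2012, status: disputed] -/
theorem baseThetaDatumStandIn_εLab (Ev : (D.baseKitNFStandIn CG hS M hA hI).EvalBinder) :
    (D.baseThetaDatumStandIn CG hS M hA hI Ev).εLab = (1 : FlStar l) := rfl

/-- The dictionary's place map is the identity. ([IUTchI] Def 6.1 p.156) [claim: Mochizuki2012, status: disputed] -/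
theorem kitCoreStandIn_e (Ev : (D.baseKitNFStandIn CG hS M hA hI).EvalBinder) (x : D.IndexCopy) :
    (D.kitCoreStandIn CG hS M hA hI Ev).e x = x := rfl

/-- **NON-VACUITY of `KitCore` at the genuine kit**, modulo `E`: for every evaluation-section binder there IS a §4 datum of the real
initial Θ-data in `𝒟`-dictionary with abc-iut-L5-t4's §6 base kit. ([IUTchI] Def 6.1 p.156) [claim: Mochizuki2012, status: disputed] -/
theorem nonempty_kitCore_baseKitNFStandIn (Ev : (D.baseKitNFStandIn CG hS M hA hI).EvalBinder) :
    Nonempty ((D.baseThetaDatumStandIn CG hS M hA hI Ev).KitCore (D.baseKitNFStandIn CG hS M hA hI)) :=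
  ⟨D.kitCoreStandIn CG hS M hA hI Ev⟩

/-! ### Law (γ) `ThetaAgrees` at the genuine kit, for Example 4.4's classes generated by a multiplicative kit -/

/-- **(γ) `ThetaAgrees` AT THE GENUINE KIT** (Prop 6.7: «the poly-morphisms described in Example 4.4 (i), (ii)» ARE the kit's `φ^Θ_{v̲_j}`): over the
§4 datum whose evaluation sections are Example 4.4's classes generated by a multiplicative kit `Mk` of `baseKitNFStandIn` (zero class `Z`, every label
occurring `hne`, labels rigid `hrig` — KitNFSideEval `MultKit.evalBinder`), the identification HOLDS provided `Mk`'s classes are bi-saturated under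
`Aut(𝒟_v̲)` (`hsat`; Ex 4.4 (ii) «composing with arbitrary isomorphisms») — abc-iut-L5-t3's `thetaAgrees_ofKit` at genuine data.  (J-Θ-1: such an `Mk`
is itself a stand-in in the Π-avatar.) ([IUTchI] Prop 6.7 p.167) [claim: Mochizuki2012, status: disputed] -/
theorem thetaAgrees_standIn (Mk : (D.baseKitNFStandIn CG hS M hA hI).MultKit)
    (Z : ∀ x : D.IndexCopy, x ∈ D.indexCopyBad →
      Set ((D.baseKitNFStandIn CG hS M hA hI).model x ⟶ (D.baseKitNFStandIn CG hS M hA hI).model x))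
    (hne : ∀ x (hx : x ∈ D.indexCopyBad) j, (Mk.polyOfLabel D.five_le_l Z x hx j).Nonempty)
    (hrig : ∀ x (hx : x ∈ D.indexCopyBad) {j j' : FlAbs l}
      {g g' : (D.baseKitNFStandIn CG hS M hA hI).model x ⟶ (D.baseKitNFStandIn CG hS M hA hI).model x}
      (θ β : (D.baseKitNFStandIn CG hS M hA hI).model x ≅ (D.baseKitNFStandIn CG hS M hA hI).model x),
      g ∈ Mk.polyOfLabel D.five_le_l Z x hx j → g' ∈ Mk.polyOfLabel D.five_le_l Z x hx j' → g' = θ.hom ≫ g ≫ β.hom → j = j')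
    (hsat : ∀ x (hx : x ∈ D.indexCopyBad) (j : Fin (lStar l))
      (θ β : (D.baseKitNFStandIn CG hS M hA hI).model x ≅ (D.baseKitNFStandIn CG hS M hA hI).model x)
      {g : (D.baseKitNFStandIn CG hS M hA hI).model x ⟶ (D.baseKitNFStandIn CG hS M hA hI).model x},
      g ∈ Mk.thetaPolyBad j x hx → θ.hom ≫ g ≫ β.hom ∈ Mk.thetaPolyBad j x hx) :
    (D.kitCoreStandIn CG hS M hA hI (Mk.evalBinder D.five_le_l Z hne hrig)).ThetaAgrees Mk :=
  BaseThetaDatum.thetaAgrees_ofKit (D.baseKitNFStandIn CG hS M hA hI) D.five_le_l (D.indexCopy_not_mem_arc_of_mem_bad)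
    D.indexCopyBad_nonempty (D.nfKitStandIn CG hS M hA hI) (PMBaseKit.MonoBinder.tautological _) Mk Z hne hrig hsat

end InitialThetaData

end KitCoreAtGenuineKit

end Literature.IUT.HodgeTheaters
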